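import Mathlib
import Summits.MatrixMultiplication.MatrixMultiplication.Theses.HiddenToeplitzCorners
import Summits.MatrixMultiplication.MatrixMultiplication.Cruxes.HiddenCorners.LawOfEnds

/-!
# The compression stratum of crux `HiddenCorners` (stmt-MatrixMultiplication-7492) — typed targets (strategist h1, census gen 3)

Companion of `STRATEGY-CENSUS.md` (gen 3, §H) and of `LawOfEnds.lean` (gen 1).  Disproof-side / calibration
material about ONE sub-class of the crux, the COMPRESSION STRATUM (RankStratumR2K4.md lever L1, left "INCONCLUSIVE"
for dense generators by kit j019693):

    T(X) = U (X ⊗ 1_m) Vᵀ,   i.e.  T a b = U_a · V_bᵀ  with  U_a, V_b ∈ ℂ^{N × m}  AND  m (r-1) < N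
    (the "rank stratum": flattening rank ≤ m < N/(r-1); WITHOUT the constraint on m the form is no restriction at all —
    every pencil is U (X ⊗ 1_{rN}) Vᵀ — so the constraint is part of the definition).

On this stratum clause (iii) of the crux is automatic (rank T(X) ≤ m·rank X < N on D_r), clause (ii) forces N ≤ r m and
is the open condition `det (Σ_a U_a V_aᵀ) ≠ 0` at full size `N = r m`, and the WHOLE content of the crux is the
displacement condition.  This file types:

* `compressionPencil`, `CompressionHiddenCorners` (the crux restricted to the stratum; it implies the crux,
  `hiddenCorners_of_compression`, PROVED — so a witness here closes the crux, and a law here closes only the stratum);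
* `CompressionNeutralLaw c k` and the PROVED bridge `compressionNeutralLaw_refutes` (any polynomial law on the
  stratum refutes `CompressionHiddenCorners`; same real analysis as `LawOfEnds.splitNeutralLaw_refutes`);
* the two statements the census reduces the full-size stratum to (census §N6; COMPLETE PAPER PROOFS in the crux
  workfile `CommutantRank.md`, formalisation pending): `ApproxDoubleCommutant f` ("COMM": if every commutator of
  `P ∈ M_r ⊗ M_m` with `M_r ⊗ 1` has rank ≤ ρ then `P` is within rank `f ρ` of the commutant `1 ⊗ M_m`, with
  `f ρ = 3ρ + 2ρ² + (7ρ + 4ρ²)²/2`, INDEPENDENT of `r, m` — proved via a block CUT LEMMA (Schur-complement pivot) and a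
  majority/irreducibility argument) and `CyclicCommutatorLaw` / `CyclicCommutatorLawPoly` ("CSL": a cyclic =
  nonderogatory `P` on `ℂ^r ⊗ ℂ^m` has a commutator of rank `ρ` with `r ≤ f ρ + 1` against some `X ⊗ 1`), with the
  Lean-PROVED implication `csl_of_comm` / `cslPoly_of_comm` from COMM and the Lean-PROVED cyclicity-cost lemma
  `cyclicityCost` (Krylov dimension count + Cayley–Hamilton).
* `FullSizeReduction` (Prop; paper proof, 5 lines, census §N6(b)): at full size `N = r m`, Stein rank ≤ δ for all `X`
  gives `rank [U⁻¹ZU, X ⊗ 1] ≤ 2δ + 1`; with CSL: **r ≤ f (2δ+1) + 1 — a polynomial ω-neutral law on the full-size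
  stratum, proved on paper this pass**; through `compressionNeutralLaw_refutes` it refutes the full-size part of
  `CompressionHiddenCorners`.  The properly compressed window `m (r-1) < N < r m` is NOT covered (census §N6).

Nothing in this file is a line (`HiddenCorners_of` is absent on purpose).
-/

set_option linter.dupNamespace false
set_option linter.unusedVariables false

namespace Summit.MatrixMultiplication.MatrixMultiplication.Cruxes.HiddenCorners.CompressionStratum

open Summit.MatrixMultiplication.MatrixMultiplication.Theses.HiddenToeplitzCorners
open Summit.MatrixMultiplication.MatrixMultiplication.Cruxes.HiddenCorners.LawOfEnds
  (shiftZ SplitSP SplitNeutralLaw eventually_law_lt)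
open scoped BigOperators Matrix Kronecker
open Filter

/-- The compression-form pencil `T a b = U a * (V b)ᵀ` (flattening rank ≤ m; `T(X) = U (X ⊗ 1_m) Vᵀ`). -/
def compressionPencil (r N m : ℕ) (U V : Fin r → Matrix (Fin N) (Fin m) ℂ) :
    Fin r → Fin r → Matrix (Fin N) (Fin N) ℂ :=
  fun a b => U a * (V b)ᵀ

/-- **The crux restricted to the compression (rank) stratum** (`CompressionHiddenCorners`): the body of `HiddenCorners`
verbatim, with the pencil constrained to compression form `T a b = U_a V_bᵀ`, `U_a, V_b ∈ ℂ^{N×m}`, `m (r-1) < N`. -/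
def CompressionHiddenCorners : Prop :=
  ∀ ε : ℝ, 0 < ε → ∃ᶠ r : ℕ in Filter.atTop, ∃ (N d m : ℕ) (U V : Fin r → Matrix (Fin N) (Fin m) ℂ),
    (N : ℝ) ≤ (r : ℝ) ^ (2 + ε) ∧ (d : ℝ) ≤ (r : ℝ) ^ ε ∧ m * (r - 1) < N ∧
    ∃ (G₀ H₀ : Matrix (Fin N) (Fin d) ℂ) (G₁ H₁ : Fin r → Fin r → Matrix (Fin N) (Fin d) ℂ),
      (∀ a b, compressionPencil r N m U V a b -
          (Matrix.of fun i j : Fin N => if (i : ℕ) = (j : ℕ) + 1 then (1 : ℂ) else 0) *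
            compressionPencil r N m U V a b *
          (Matrix.of fun i j : Fin N => if (i : ℕ) = (j : ℕ) + 1 then (1 : ℂ) else 0)ᵀ
            = G₀ * (H₁ a b)ᵀ + G₁ a b * H₀ᵀ) ∧
      ((∑ a : Fin r, ∑ b : Fin r,
          ((Finset.univ.filter fun p : Fin N × Fin d => G₁ a b p.1 p.2 ≠ 0).card +
            (Finset.univ.filter fun p : Fin N × Fin d => H₁ a b p.1 p.2 ≠ 0).card) : ℕ) : ℝ)
          ≤ (r : ℝ) ^ (2 + ε) ∧
      (∃ X₀ : Matrix (Fin r) (Fin r) ℂ, (∑ a : Fin r, ∑ b : Fin r, X₀ a b • compressionPencil r N m U V a b).det ≠ 0) ∧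
      ∀ X : Matrix (Fin r) (Fin r) ℂ, X.det = 0 →
        (∑ a : Fin r, ∑ b : Fin r, X a b • compressionPencil r N m U V a b).det = 0

/-- A witness on the stratum is a witness of the crux (trivial repackaging; PROVED). -/
theorem hiddenCorners_of_compression (h : CompressionHiddenCorners) : HiddenCorners := by
  intro ε hε
  refine (h ε hε).mono ?_
  rintro r ⟨N, d, m, U, V, hN, hd, -, G₀, H₀, G₁, H₁, hdisp, hsp, hX₀, hsing⟩
  exact ⟨N, d, hN, hd, compressionPencil r N m U V, G₀, H₀, G₁, H₁, hdisp, hsp, hX₀, hsing⟩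

/-- The ω-neutral law ON THE STRATUM, polynomial form: every compression-form split-SP pencil with `m (r-1) < N` has
`r ≤ c (d+1)^k`.  (Conjectured with `k = 1`; PROVED on paper this pass for the full-size part `N = r m` with `k = 8`,
via `FullSizeReduction` + CSL + COMM; the window `m (r-1) < N < r m` is open.) -/
def CompressionNeutralLaw (c k : ℕ) : Prop :=
  ∀ (r N d m : ℕ) (U V : Fin r → Matrix (Fin N) (Fin m) ℂ), m * (r - 1) < N →
    SplitSP r N d (compressionPencil r N m U V) → r ≤ c * (d + 1) ^ k

/-- `SplitNeutralLaw` (all pencils) trivially implies the law on the stratum. -/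
theorem compressionNeutralLaw_of_split (c k : ℕ) (h : SplitNeutralLaw c k) : CompressionNeutralLaw c k :=
  fun r N d m U V _ hT => h r N d _ hT

/-- **Bridge on the stratum, proved.** Any polynomial neutral law on the compression stratum refutes
`CompressionHiddenCorners` (same real analysis as `LawOfEnds.splitNeutralLaw_refutes`). -/
theorem compressionNeutralLaw_refutes (c k : ℕ) (hk : 1 ≤ k) (hlaw : CompressionNeutralLaw c k) :
    ¬ CompressionHiddenCorners := by
  intro hH
  have hkpos : (0 : ℝ) < k := by exact_mod_cast hk
  set ε : ℝ := 1 / (2 * (k : ℝ)) with hε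
  have hεpos : 0 < ε := by rw [hε]; positivity
  have hfreq := hH ε hεpos
  have hle : ∃ᶠ r : ℕ in atTop, (r : ℝ) ≤ (c : ℝ) * ((r : ℝ) ^ ε + 1) ^ k := by
    refine hfreq.mono ?_
    rintro r ⟨N, d, m, U, V, -, hd, hmN, G₀, H₀, G₁, H₁, hdisp, -, hX₀, hsing⟩
    have hsp : SplitSP r N d (compressionPencil r N m U V) := ⟨⟨G₀, H₀, G₁, H₁, hdisp⟩, hX₀, hsing⟩
    have hr : r ≤ c * (d + 1) ^ k := hlaw r N d m U V hmN hsp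
    have hr' : (r : ℝ) ≤ (c : ℝ) * ((d : ℝ) + 1) ^ k := by exact_mod_cast hr
    have hd1 : (d : ℝ) + 1 ≤ (r : ℝ) ^ ε + 1 := by linarith
    have hdnn : (0 : ℝ) ≤ (d : ℝ) + 1 := by positivity
    calc (r : ℝ) ≤ (c : ℝ) * ((d : ℝ) + 1) ^ k := hr'
      _ ≤ (c : ℝ) * ((r : ℝ) ^ ε + 1) ^ k := by
          apply mul_le_mul_of_nonneg_left (pow_le_pow_left₀ hdnn hd1 k) (by positivity)
  have hev := eventually_law_lt c k hk
  obtain ⟨r, h1, h2⟩ := (hle.and_eventually hev).exists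
  rw [hε] at h1
  linarith

/-! ### The two linear-algebra statements the full-size stratum reduces to (census gen 3 §H)

Index convention: `ℂ^r ⊗ ℂ^m` is `Fin r × Fin m`; `X ⊗ 1` is `X ⊗ₖ (1 : Matrix (Fin m) (Fin m) ℂ)`. -/

/-- The commutator-rank profile of `P` against the algebra `M_r ⊗ 1_m`. -/
def CommRankLE (r m : ℕ) (P : Matrix (Fin r × Fin m) (Fin r × Fin m) ℂ) (ρ : ℕ) : Prop :=
  ∀ X : Matrix (Fin r) (Fin r) ℂ,
    (P * (X ⊗ₖ (1 : Matrix (Fin m) (Fin m) ℂ)) - (X ⊗ₖ (1 : Matrix (Fin m) (Fin m) ℂ)) * P).rank ≤ ρ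

/-- **COMM** (approximate double commutant in rank metric): if every commutator of `P` with `M_r ⊗ 1` has rank ≤ ρ,
then `P` is within rank `f ρ` of the commutant `1 ⊗ M_m` — with `f` INDEPENDENT of `r` and `m`.
PROVED ON PAPER this pass (crux workfile `CommutantRank.md`) with `f ρ = 3ρ + 2ρ² + (7ρ + 4ρ²)²/2`:
(1) `X = 1_S` (subset indicators) bounds every block cut of `P`; (2) CUT LEMMA: all block cuts of rank ≤ ρ ⇒
`P = Δ + R₁`, `Δ` block-diagonal, `rank R₁ ≤ 3ρ + 2ρ²` (Schur-complement pivot at a maximal off-diagonal minor);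
(3) `X = J` puts all `Δ_a − Δ_1` in one column space and one row space of dimension `ρ′ = ρ + 2 rank R₁`;
(4) `X =` permutations, after a rank-one contraction of the `W` factor, force all but ≤ ρ′/2 of the `Δ_a` to coincide
(majority + irreducibility).  Conjectured sharp form: `f ρ = 2ρ`.  Formalisation pending. -/
def ApproxDoubleCommutant (f : ℕ → ℕ) : Prop :=
  ∀ (r m ρ : ℕ) (P : Matrix (Fin r × Fin m) (Fin r × Fin m) ℂ), CommRankLE r m P ρ →
    ∃ C : Matrix (Fin m) (Fin m) ℂ, (P - (1 : Matrix (Fin r) (Fin r) ℂ) ⊗ₖ C).rank ≤ f ρ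

/-- `P` is cyclic (nonderogatory): some vector has a spanning Krylov sequence. -/
def IsCyclicOp {n : Type*} [Fintype n] [DecidableEq n] (P : Matrix n n ℂ) : Prop :=
  ∃ v : n → ℂ, Submodule.span ℂ (Set.range fun k : ℕ => (P ^ k).mulVec v) = ⊤

/-- **Cyclicity cost** (PROVED): if `P = 1 ⊗ C + R` on `ℂ^r ⊗ ℂ^m` is cyclic
then `r ≤ rank R + 1` (the Krylov space of any vector lies in the `ℂ[1 ⊗ C]`-module generated by the vector and
`im R`, of dimension ≤ m (1 + rank R)).  `0 < m` is needed: for `m = 0` everything is vacuous and `r` is free. -/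
theorem cyclicityCost (r m : ℕ) (hm : 0 < m) (C : Matrix (Fin m) (Fin m) ℂ)
    (R : Matrix (Fin r × Fin m) (Fin r × Fin m) ℂ)
    (hcyc : IsCyclicOp ((1 : Matrix (Fin r) (Fin r) ℂ) ⊗ₖ C + R)) : r ≤ R.rank + 1 := by
  classical
  obtain ⟨v, hv⟩ := hcyc
  set A : Matrix (Fin r × Fin m) (Fin r × Fin m) ℂ := (1 : Matrix (Fin r) (Fin r) ℂ) ⊗ₖ C with hA
  -- (1) powers of `A = 1 ⊗ C`
  have hApow : ∀ k : ℕ, A ^ k = (1 : Matrix (Fin r) (Fin r) ℂ) ⊗ₖ (C ^ k) := by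
    intro k
    induction k with
    | zero => rw [pow_zero, pow_zero, Matrix.one_kronecker_one]
    | succ k ih => rw [pow_succ, ih, hA, ← Matrix.mul_kronecker_mul, Matrix.one_mul, ← pow_succ]
  -- (2) Cayley–Hamilton for `C`, transported to `A`: `A ^ m` is a combination of lower powers
  obtain ⟨c, hc⟩ : ∃ c : ℕ → ℂ, A ^ m = ∑ j ∈ Finset.range m, c j • A ^ j := by
    have h0 := Matrix.aeval_self_charpoly C
    have hdeg : C.charpoly.natDegree = m := by
      rw [Matrix.charpoly_natDegree_eq_dim, Fintype.card_fin]
    have hlead : C.charpoly.coeff m = 1 := by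
      have h := (Matrix.charpoly_monic C).coeff_natDegree
      rwa [hdeg] at h
    rw [Polynomial.aeval_eq_sum_range, hdeg, Finset.sum_range_succ, hlead, one_smul] at h0
    have hCm : C ^ m = ∑ j ∈ Finset.range m, (-C.charpoly.coeff j) • C ^ j := by
      have h1 : C ^ m = -∑ j ∈ Finset.range m, C.charpoly.coeff j • C ^ j :=
        eq_neg_of_add_eq_zero_right h0
      rw [h1, ← Finset.sum_neg_distrib]
      exact Finset.sum_congr rfl fun j _ => (neg_smul _ _).symm
    refine ⟨fun j => -C.charpoly.coeff j, ?_⟩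
    let L : Matrix (Fin m) (Fin m) ℂ →ₗ[ℂ] Matrix (Fin r × Fin m) (Fin r × Fin m) ℂ :=
      { toFun := fun B => (1 : Matrix (Fin r) (Fin r) ℂ) ⊗ₖ B
        map_add' := fun B₁ B₂ => Matrix.kronecker_add _ _ _
        map_smul' := fun a B => by
          simp only [RingHom.id_apply]
          exact Matrix.kronecker_smul _ _ _ }
    have hL : ∀ B, L B = (1 : Matrix (Fin r) (Fin r) ℂ) ⊗ₖ B := fun B => rfl
    have h2 := congrArg L hCm
    rw [map_sum] at h2
    rw [hL, ← hApow] at h2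
    rw [h2]
    refine Finset.sum_congr rfl fun j _ => ?_
    rw [hL, Matrix.kronecker_smul, ← hApow j]
  -- (3) the `A`-stable submodule generated by `v` and `im R`
  let S : Submodule ℂ (Fin r × Fin m → ℂ) := (ℂ ∙ v) ⊔ LinearMap.range (Matrix.mulVecLin R)
  let N : Fin m → Submodule ℂ (Fin r × Fin m → ℂ) := fun j => S.map (Matrix.mulVecLin (A ^ (j : ℕ)))
  let M : Submodule ℂ (Fin r × Fin m → ℂ) := ⨆ j : Fin m, N j
  have hSM : S ≤ M := by
    have h0 : N ⟨0, hm⟩ = S := by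
      show S.map (Matrix.mulVecLin (A ^ ((⟨0, hm⟩ : Fin m) : ℕ))) = S
      simp [Matrix.mulVecLin_one]
    calc S = N ⟨0, hm⟩ := h0.symm
      _ ≤ M := le_iSup N ⟨0, hm⟩
  have hpowmem : ∀ (k : ℕ) (x : Fin r × Fin m → ℂ), x ∈ S → (A ^ k) *ᵥ x ∈ M := by
    intro k
    induction k using Nat.strong_induction_on with
    | _ k ih =>
      intro x hx
      by_cases hk : k < m
      · exact Submodule.mem_iSup_of_mem (⟨k, hk⟩ : Fin m) ⟨x, hx, rfl⟩
      · obtain ⟨t, rfl⟩ : ∃ t, k = t + m := ⟨k - m, by omega⟩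
        rw [pow_add, hc, Finset.mul_sum, Matrix.sum_mulVec]
        refine Submodule.sum_mem _ fun j hj => ?_
        have hjm : j < m := Finset.mem_range.mp hj
        rw [Matrix.mul_smul, Matrix.smul_mulVec, ← pow_add]
        exact Submodule.smul_mem _ _ (ih (t + j) (by omega) x hx)
  have hAM : ∀ x ∈ M, A *ᵥ x ∈ M := by
    intro x hx
    refine Submodule.iSup_induction N (motive := fun y => A *ᵥ y ∈ M) hx ?_ ?_ ?_
    · rintro j y ⟨s, hs, rfl⟩
      show A *ᵥ ((A ^ (j : ℕ)) *ᵥ s) ∈ M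
      rw [Matrix.mulVec_mulVec, ← pow_succ']
      exact hpowmem _ s hs
    · rw [Matrix.mulVec_zero]; exact M.zero_mem
    · intro y z hy hz
      rw [Matrix.mulVec_add]; exact M.add_mem hy hz
  have hRM : ∀ x, R *ᵥ x ∈ M := fun x => hSM (Submodule.mem_sup_right ⟨x, rfl⟩)
  have hvM : v ∈ M := hSM (Submodule.mem_sup_left (Submodule.mem_span_singleton_self v))
  have hKry : ∀ k : ℕ, ((A + R) ^ k) *ᵥ v ∈ M := by
    intro k
    induction k with
    | zero => simpa using hvM
    | succ k ih =>
      rw [pow_succ', ← Matrix.mulVec_mulVec, Matrix.add_mulVec]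
      exact M.add_mem (hAM _ ih) (hRM _)
  have htop : M = ⊤ := by
    rw [eq_top_iff, ← hv, Submodule.span_le]
    rintro _ ⟨k, rfl⟩
    exact hKry k
  -- (4) dimension count
  have hiSup : ∀ s : Finset (Fin m),
      Module.finrank ℂ ↥(⨆ j ∈ s, N j) ≤ ∑ j ∈ s, Module.finrank ℂ ↥(N j) := by
    intro s
    induction s using Finset.induction_on with
    | empty => simp
    | insert a s ha ih =>
      rw [Finset.iSup_insert, Finset.sum_insert ha]
      exact le_trans (Submodule.finrank_add_le_finrank_add_finrank _ _) (by omega)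
  have hN : ∀ j, Module.finrank ℂ ↥(N j) ≤ Module.finrank ℂ S := fun j => Submodule.finrank_map_le _ _
  have h1 : Module.finrank ℂ M ≤ m * Module.finrank ℂ S := by
    have hM' : M = ⨆ j ∈ (Finset.univ : Finset (Fin m)), N j := by
      show (⨆ j : Fin m, N j) = ⨆ j ∈ (Finset.univ : Finset (Fin m)), N j
      simp
    calc Module.finrank ℂ M = Module.finrank ℂ ↥(⨆ j ∈ (Finset.univ : Finset (Fin m)), N j) := by
            rw [hM']
      _ ≤ ∑ j ∈ (Finset.univ : Finset (Fin m)), Module.finrank ℂ ↥(N j) := hiSup _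
      _ ≤ ∑ _j ∈ (Finset.univ : Finset (Fin m)), Module.finrank ℂ S := Finset.sum_le_sum fun j _ => hN j
      _ = m * Module.finrank ℂ S := by simp
  have h2 : Module.finrank ℂ S ≤ 1 + R.rank := by
    calc Module.finrank ℂ S
        ≤ Module.finrank ℂ (ℂ ∙ v) + Module.finrank ℂ (LinearMap.range (Matrix.mulVecLin R)) :=
          Submodule.finrank_add_le_finrank_add_finrank _ _
      _ ≤ 1 + R.rank := by
          have ha : Module.finrank ℂ (ℂ ∙ v) ≤ 1 := by
            have := finrank_span_le_card (R := ℂ) ({v} : Set (Fin r × Fin m → ℂ))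
            simpa using this
          have hb : Module.finrank ℂ (LinearMap.range (Matrix.mulVecLin R)) ≤ R.rank := le_of_eq rfl
          omega
  have h3 : Module.finrank ℂ M = r * m := by
    rw [htop, finrank_top, Module.finrank_pi, Fintype.card_prod, Fintype.card_fin, Fintype.card_fin]
  have h4 : r * m ≤ m * (1 + R.rank) :=
    calc r * m = Module.finrank ℂ M := h3.symm
      _ ≤ m * Module.finrank ℂ S := h1
      _ ≤ m * (1 + R.rank) := Nat.mul_le_mul_left m h2
  have h5 : r ≤ 1 + R.rank := Nat.le_of_mul_le_mul_right (by simpa [mul_comm] using h4) hm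
  omega

/-- **CSL** (cyclic-commutator law, LINEAR form with constant `c`): a cyclic `P` on `ℂ^r ⊗ ℂ^m` has, against some
`X ⊗ 1`, a commutator of rank `ρ` with `r ≤ c (ρ + 1)`.  Conjectured with `c = 2` or so (the `birth` lead announces
`r ≤ ρ + O(1)`); the POLYNOMIAL form `CyclicCommutatorLawPoly` below is proved on paper (COMM + `cyclicityCost`). -/
def CyclicCommutatorLaw (c : ℕ) : Prop :=
  ∀ (r m ρ : ℕ) (P : Matrix (Fin r × Fin m) (Fin r × Fin m) ℂ), 0 < m → IsCyclicOp P → CommRankLE r m P ρ →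
    r ≤ c * (ρ + 1)

/-- COMM with a linear bound `f ρ ≤ a ρ + b` gives CSL with constant `a + b + 1` (PROVED modulo `cyclicityCost`). -/
theorem csl_of_comm (a b : ℕ) (f : ℕ → ℕ) (hf : ∀ ρ, f ρ ≤ a * ρ + b) (hC : ApproxDoubleCommutant f) :
    CyclicCommutatorLaw (a + b + 1) := by
  intro r m ρ P hm hcyc hcomm
  obtain ⟨C, hPC⟩ := hC r m ρ P hcomm
  set R := P - (1 : Matrix (Fin r) (Fin r) ℂ) ⊗ₖ C with hR
  have hP : (1 : Matrix (Fin r) (Fin r) ℂ) ⊗ₖ C + R = P := by rw [hR]; abel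
  have hcyc' : IsCyclicOp ((1 : Matrix (Fin r) (Fin r) ℂ) ⊗ₖ C + R) := by rw [hP]; exact hcyc
  have h1 : r ≤ R.rank + 1 := cyclicityCost r m hm C R hcyc'
  have h2 : R.rank ≤ a * ρ + b := le_trans hPC (hf ρ)
  nlinarith

/-- **CSL, polynomial form**: a cyclic `P` on `ℂ^r ⊗ ℂ^m` (`m ≥ 1`) with all commutators against `M_r ⊗ 1` of rank
≤ ρ has `r ≤ f ρ + 1`.  PROVED on paper for `f ρ = 3ρ + 2ρ² + (7ρ + 4ρ²)²/2` (COMM + `cyclicityCost`). -/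
def CyclicCommutatorLawPoly (f : ℕ → ℕ) : Prop :=
  ∀ (r m ρ : ℕ) (P : Matrix (Fin r × Fin m) (Fin r × Fin m) ℂ), 0 < m → IsCyclicOp P → CommRankLE r m P ρ →
    r ≤ f ρ + 1

/-- COMM with ANY bound `f` gives the polynomial CSL with the same `f` (PROVED, from `cyclicityCost`). -/
theorem cslPoly_of_comm (f : ℕ → ℕ) (hC : ApproxDoubleCommutant f) : CyclicCommutatorLawPoly f := by
  intro r m ρ P hm hcyc hcomm
  obtain ⟨C, hPC⟩ := hC r m ρ P hcomm
  set R := P - (1 : Matrix (Fin r) (Fin r) ℂ) ⊗ₖ C with hR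
  have hP : (1 : Matrix (Fin r) (Fin r) ℂ) ⊗ₖ C + R = P := by rw [hR]; abel
  have hcyc' : IsCyclicOp ((1 : Matrix (Fin r) (Fin r) ℂ) ⊗ₖ C + R) := by rw [hP]; exact hcyc
  have h1 : r ≤ R.rank + 1 := cyclicityCost r m hm C R hcyc'
  omega

/-- The bound of the paper proof of COMM (census §N6(d), `CommutantRank.md`). -/
def commBound (ρ : ℕ) : ℕ := 3 * ρ + 2 * ρ ^ 2 + (7 * ρ + 4 * ρ ^ 2) ^ 2 / 2

/-! ### Reduction of the full-size stratum to CSL (census §N6(b), paper proof; recorded as a Prop)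

For `N = r m` and the assembled `U, V ∈ GL_N`: if `rank ∇T(X) ≤ δ` for all `X` then, with the CYCLIC NILPOTENT
`P := U⁻¹ Z U` (and `Q := Vᵀ Zᵀ V⁻ᵀ`, `P Q = 1 - F`, `rank F ≤ δ` from `X = 1`), one has
`A - P A Q = [A, P] Q + A F`, hence `rank [P, X ⊗ 1] ≤ 2δ + 1` for every `X` (Sylvester, `rank Q = N - 1`).
So CSL with constant `c` gives the stratum law `r ≤ c (2δ + 2) ≤ c (4 d + 2)`, and the proved polynomial CSL gives
`r ≤ commBound (2δ+1) + 1 = O(δ⁴) = O(d⁴)` — a `CompressionNeutralLaw`-type law for the FULL-SIZE stratum, proved on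
paper this pass, and through `compressionNeutralLaw_refutes` the end of lever L1 there.
The properly compressed window `m (r-1) < N < r m` is NOT covered by this reduction (census §N6). -/
def FullSizeReduction : Prop :=
  ∀ (r m δ : ℕ) (U V : Matrix (Fin r × Fin m) (Fin r × Fin m) ℂ) (Z : Matrix (Fin r × Fin m) (Fin r × Fin m) ℂ),
    IsUnit U.det → IsUnit V.det → IsCyclicOp Z → Z ^ (r * m) = 0 →
    (∀ X : Matrix (Fin r) (Fin r) ℂ,
      (U * (X ⊗ₖ (1 : Matrix (Fin m) (Fin m) ℂ)) * Vᵀ - Z * (U * (X ⊗ₖ (1 : Matrix (Fin m) (Fin m) ℂ)) * Vᵀ) * Zᵀ).rank ≤ δ) →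
    CommRankLE r m (U⁻¹ * Z * U) (2 * δ + 1)

end Summit.MatrixMultiplication.MatrixMultiplication.Cruxes.HiddenCorners.CompressionStratum
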